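import Mathlib
import HarnessLib
import Summits.Ventures.LatticeQCDFlow.Scoring.IMHWeightBlindTau
import Summits.Ventures.LatticeQCDFlow.Scaling.Bhattacharyya

/-!
# LatticeQCDFlow / Scoring — the weight-blind `τ_int` of the exact flow-MCMC (IMH) chain is pinned by
# the two printed monitors: `1/ESS − 1/2 ≤ τ_int(f) ≤ (1/ESS + 1/4)/(1 − TV) − 1/2 ≤ (1/ESS + 1/4)/ā − 1/2`

HONEST FRAMING: exact (Metropolis-corrected) sampling algorithms for lattice gauge theory;
figures of merit are autocorrelation/cost numbers at stated couplings and volumes; no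
continuum-physics claim.

Venture `LatticeQCDFlow` (cell pub-lqcd), sub-topic `Scoring`; FANOUT row 3 (`s0-u1-a`, S0-B
implementation A — deliverables 'IMH chains' and 'per-sector ESS', GEN-11).  NEW WORK of the cell
(two one-line weight inequalities inserted in row 8's weight-blind `τ` law), not a published result;
NO definition is introduced.  Setting and objects of row 8's `Scoring/IMHWeightBlindTau` (imported):
finite product space `level × label`, target `pL ⊗ μ`, model `qL ⊗ μ` (`pL, qL > 0` normalised, the
label law `μ` shared), weight `w = pL/qL` a function of the level, move-acceptance
`a(l) = 1 − liuG pL qL l l = Σ_z min(qL z, pL z·qL l/pL l)`, and for every non-constant WEIGHT-BLIND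
observable `f(l, y) = g(y)` the law `τ_int(f) = E_p[1/a(W)] − 1/2 = Σ_l pL l / a(l) − 1/2`
(`blind_tauInt_eq`), with the Jensen floor `τ_int ≥ 1/ā − 1/2` (`blind_tauInt_ge`) and the
envelope `τ_int ≤ w⋆ − 1/2` (`IMHAutocorrelationEnvelope`).  Also used: `essFrac`, `weight`
(row 31's `Scaling/ImportanceWeights`), `tvDist`, `Σ min(p, q) = 1 − TV`
(`Theory2.sum_min_eq_one_sub_tvDist`, row 31's `Scaling/Bhattacharyya`, imported) and
`accRate_le` (`ā ≤ 1 − TV`, row 30's `Exactness/FlowMCMC`).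

## Content (any finite level space `X`, `p, q > 0`, `Σ p = Σ q = 1`)

* `moveAccept_le_inv_weight` — `a(x) ≤ q x / p x = 1/w(x)` (`min(q_z, p_z/w_x) ≤ p_z/w_x`, `Σ p = 1`);
  hence **`inv_essFrac_le_sum_div_moveAccept`** — `1/ESS = E_p[w] ≤ E_p[1/a] = Σ_x p_x/a(x)`;
* `overlap_le_moveAccept_mul_max` — `Σ_z min(p_z, q_z) ≤ a(x) · max(1, w(x))`
  (`min(p_z, q_z) ≤ min(q_z, p_z/w_x)·max(1, w_x)` termwise); `mul_max_one_weight_le` —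
  `p_x·max(1, w_x) ≤ p_x w_x + q_x/4` (`w ≤ w² + ¼`); hence **`sum_div_moveAccept_le`** —
  `Σ_x p_x/a(x) ≤ (1/ESS + 1/4)/(1 − TV(p, q))` and `… ≤ (1/ESS + 1/4)/ā`
  (`sum_div_moveAccept_le_div_accRate`);
* on the chain (row 8's product setting): **`blind_tauInt_ge_inv_essFrac`** —
  `τ_int(f) ≥ 1/ESS − 1/2` for every non-constant weight-blind `f` — a floor from the reweighting ESS
  that dominates the acceptance floor `1/ā − 1/2` whenever `ESS < ā` (row 3's `acc ≥ (8/9)·ESS` says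
  it is never worse by more than `9/8`); **`blind_tauInt_le_of_essFrac_tvDist`** —
  `τ_int(f) ≤ (1/ESS + 1/4)/(1 − TV(pL, qL)) − 1/2`, and **`blind_tauInt_le_of_essFrac_accRate`** —
  `τ_int(f) ≤ (1/ESS + 1/4)/ā − 1/2`: the weight-blind autocorrelation time is CONTROLLED by the two
  printed population monitors (ESS fraction and acceptance), with no reference to the weight ceiling
  `w⋆` of the envelope (which may exceed `1/ESS` by orders of magnitude).

* (appended, GEN-11) `inv_le_moveAccept` — the per-state floor `a(x) ≥ 1/(1/ESS + w(x))`
  (Cauchy–Schwarz on `a(x) = E_p[1/max(w, w_x)]`; the continuum statement is Deligiannidis–Lee 2018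
  §3, in the tree as row 2's `Exactness.one_sub_rejCurve_ge`), hence
  `sum_div_moveAccept_le_two_inv_essFrac` (`E_p[1/a] ≤ 2/ESS`) and
  **`blind_tauInt_le_two_inv_essFrac`** / **`blind_tauInt_mem_Icc_essFrac`** —
  `1/ESS − 1/2 ≤ τ_int(f) ≤ 2/ESS − 1/2`: the weight-blind `τ_int` IS `1/ESS` within a factor `2`.

* (appended, GEN-11) `blind_one_add_two_mul_tauInt_mem_Icc` — the chain's variance-inflation factor `(1 + 2τ_int)·ESS ∈ [2, 4]` (reweighting the same proposals
  has inflation `1/ESS` on weight-independent observables: the chain costs `2×`–`4×`).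

Reading (value-free): for observables that do not see the importance weight, the exact chain
decorrelates in about `1/ESS` proposals — at least `1/ESS − 1/2`, at most `2/ESS − 1/2`.
The floor is an equality exactly when `h₁ ≡ 1`, i.e. for the perfect flow among positive pairs (and
for the hit-or-miss flows in the closure).  NOT CLAIMED: anything for observables correlated with the
weight (the level decomposition `Scoring/IMHLevelDecompositionTau` is the tool there); any `τ`, ESS
or acceptance of ours; nothing re-scored.
-/

namespace Summit.Ventures.LatticeQCDFlow.Scoring

open Finset Literature.Probability.MarkovChains Summit.Ventures.LatticeQCDFlow.Exactness
open Summit.Ventures.LatticeQCDFlow.Theory2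

/-! ### Weight inequalities for the move-acceptance `a(x) = 1 − liuG p q x x` -/

section MoveAccept

variable {X : Type*} [Fintype X] [DecidableEq X]

/-- **`a(x) ≤ 1/w(x)`**: `a(x) = Σ_z min(q_z, p_z·q_x/p_x) ≤ Σ_z p_z·q_x/p_x = q_x/p_x` for a
normalised target. [ours] -/
theorem moveAccept_le_inv_weight {p q : X → ℝ} (hp : ∀ x, 0 < p x) (hp1 : ∑ x, p x = 1) (x : X) :
    1 - liuG p q x x ≤ q x / p x := by
  rw [one_sub_liuG_diag_eq_sum_min hp x]
  calc ∑ z, min (q z) (p z * q x / p x) ≤ ∑ z, p z * q x / p x :=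
        sum_le_sum fun z _ => min_le_right _ _
    _ = q x / p x := by
        rw [← sum_div, ← sum_mul, hp1, one_mul]

/-- **`1/ESS ≤ E_p[1/a]`**: `(essFrac p q)⁻¹ = Σ_x p_x w_x ≤ Σ_x p_x / a(x)` (`1/a(x) ≥ w_x`).
[ours] -/
theorem inv_essFrac_le_sum_div_moveAccept {p q : X → ℝ} (hp : ∀ x, 0 < p x) (hq : ∀ x, 0 < q x)
    (hp1 : ∑ x, p x = 1) :
    (essFrac p q)⁻¹ ≤ ∑ x, p x / (1 - liuG p q x x) := by
  rw [essFrac_eq_inv hq hp1, inv_inv]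
  refine sum_le_sum fun x _ => ?_
  have ha : 0 < 1 - liuG p q x x := one_sub_liuG_diag_pos hp hq x
  calc p x * weight p q x = p x / (q x / p x) := by
        rw [weight, div_div_eq_mul_div, mul_div_assoc]
    _ ≤ p x / (1 - liuG p q x x) :=
        div_le_div_of_nonneg_left (hp x).le ha (moveAccept_le_inv_weight hp hp1 x)

/-- **The overlap controls the move-acceptance from below**:
`Σ_z min(p_z, q_z) ≤ a(x) · max(1, w_x)` — termwise `min(p_z, q_z) ≤ min(q_z, p_z/w_x)·max(1, w_x)`.
[ours] -/
theorem overlap_le_moveAccept_mul_max {p q : X → ℝ} (hp : ∀ x, 0 < p x) (hq : ∀ x, 0 < q x)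
    (x : X) :
    ∑ z, min (p z) (q z) ≤ (1 - liuG p q x x) * max 1 (p x / q x) := by
  rw [one_sub_liuG_diag_eq_sum_min hp x, sum_mul]
  refine sum_le_sum fun z _ => ?_
  have hw : 0 < p x / q x := div_pos (hp x) (hq x)
  have e : p z * q x / p x = p z / (p x / q x) := by
    field_simp
  rw [e]
  rcases le_total (p x / q x) 1 with hw1 | hw1
  · -- light state: `max(1, w) = 1`, and `p_z ≤ p_z / w`
    rw [max_eq_left hw1, mul_one]
    refine (min_comm _ _).le.trans (min_le_min le_rfl ?_)
    rw [le_div_iff₀ hw]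
    calc p z * (p x / q x) ≤ p z * 1 := mul_le_mul_of_nonneg_left hw1 (hp z).le
      _ = p z := mul_one _
  · -- heavy state: `max(1, w) = w`, and `min(q_z, p_z/w)·w = min(q_z w, p_z)`
    rw [max_eq_right hw1, min_mul_of_nonneg _ _ hw.le, div_mul_cancel₀ _ hw.ne']
    refine (min_comm _ _).le.trans (min_le_min ?_ le_rfl)
    calc q z = q z * 1 := (mul_one _).symm
      _ ≤ q z * (p x / q x) := mul_le_mul_of_nonneg_left hw1 (hq z).le

omit [Fintype X] [DecidableEq X] in
/-- `p_x · max(1, w_x) ≤ p_x w_x + q_x/4` (because `w ≤ w² + 1/4`). [ours] -/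
theorem mul_max_one_weight_le {p q : X → ℝ} (hq : ∀ x, 0 < q x) (x : X) :
    p x * max 1 (p x / q x) ≤ p x * (p x / q x) + q x / 4 := by
  have hpq : p x = q x * (p x / q x) := by rw [mul_div_cancel₀ _ (hq x).ne']
  rcases le_total (p x / q x) 1 with hw1 | hw1
  · rw [max_eq_left hw1, mul_one]
    nlinarith [sq_nonneg (p x / q x - 1 / 2), (hq x).le, hpq]
  · rw [max_eq_right hw1]
    linarith [(hq x).le]

/-- **`E_p[1/a] ≤ (1/ESS + 1/4)/(1 − TV)`**: for positive normalised `p`, `q`,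
`Σ_x p_x / a(x) ≤ ((essFrac p q)⁻¹ + 1/4)/(1 − tvDist p q)`. [ours] -/
theorem sum_div_moveAccept_le {p q : X → ℝ} (hp : ∀ x, 0 < p x) (hq : ∀ x, 0 < q x)
    (hp1 : ∑ x, p x = 1) (hq1 : ∑ x, q x = 1) :
    ∑ x, p x / (1 - liuG p q x x) ≤ ((essFrac p q)⁻¹ + 1 / 4) / (1 - tvDist p q) := by
  have hne : (univ : Finset X).Nonempty :=
    nonempty_of_sum_ne_zero (by rw [hp1]; exact one_ne_zero)
  have hO : 0 < ∑ z, min (p z) (q z) := sum_pos (fun z _ => lt_min (hp z) (hq z)) hne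
  have hOeq : ∑ z, min (p z) (q z) = 1 - tvDist p q := sum_min_eq_one_sub_tvDist hp1 hq1
  rw [← hOeq]
  have hterm : ∀ x, p x / (1 - liuG p q x x) ≤ p x * max 1 (p x / q x) / ∑ z, min (p z) (q z) := by
    intro x
    have ha : 0 < 1 - liuG p q x x := one_sub_liuG_diag_pos hp hq x
    rw [div_le_div_iff₀ ha hO]
    calc p x * ∑ z, min (p z) (q z) ≤ p x * ((1 - liuG p q x x) * max 1 (p x / q x)) :=
          mul_le_mul_of_nonneg_left (overlap_le_moveAccept_mul_max hp hq x) (hp x).le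
      _ = p x * max 1 (p x / q x) * (1 - liuG p q x x) := by ring
  calc ∑ x, p x / (1 - liuG p q x x) ≤ ∑ x, p x * max 1 (p x / q x) / ∑ z, min (p z) (q z) :=
        sum_le_sum fun x _ => hterm x
    _ = (∑ x, p x * max 1 (p x / q x)) / ∑ z, min (p z) (q z) := by rw [sum_div]
    _ ≤ ((essFrac p q)⁻¹ + 1 / 4) / ∑ z, min (p z) (q z) := by
        refine div_le_div_of_nonneg_right ?_ hO.le
        calc ∑ x, p x * max 1 (p x / q x) ≤ ∑ x, (p x * (p x / q x) + q x / 4) :=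
              sum_le_sum fun x _ => mul_max_one_weight_le hq x
          _ = (essFrac p q)⁻¹ + 1 / 4 := by
              rw [sum_add_distrib, essFrac_eq_inv hq hp1, inv_inv, ← sum_div, hq1]
              rfl

/-- … and **`E_p[1/a] ≤ (1/ESS + 1/4)/ā`**, since `ā = accRate p q ≤ 1 − TV(p, q)` (`accRate_le`).
[ours] -/
theorem sum_div_moveAccept_le_div_accRate {p q : X → ℝ} (hp : ∀ x, 0 < p x) (hq : ∀ x, 0 < q x)
    (hp1 : ∑ x, p x = 1) (hq1 : ∑ x, q x = 1) :
    ∑ x, p x / (1 - liuG p q x x) ≤ ((essFrac p q)⁻¹ + 1 / 4) / accRate p q := by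
  have hacc : 0 < accRate p q := by
    rw [← sum_mul_moveAccept_eq_accRate hp]
    exact sum_pos (fun x _ => mul_pos (hp x) (one_sub_liuG_diag_pos hp hq x))
      (nonempty_of_sum_ne_zero (by rw [hp1]; exact one_ne_zero))
  have hnum : 0 ≤ (essFrac p q)⁻¹ + 1 / 4 := by
    rw [essFrac_eq_inv hq hp1, inv_inv]
    exact add_nonneg (sum_nonneg fun x _ => mul_nonneg (hp x).le
      (div_nonneg (hp x).le (hq x).le)) (by norm_num)
  exact (sum_div_moveAccept_le hp hq hp1 hq1).trans
    (div_le_div_of_nonneg_left hnum hacc (accRate_le hp1 hq1))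

end MoveAccept


/-! ### On the chain: the weight-blind `τ_int` between `1/ESS − 1/2` and `(1/ESS + 1/4)/ā − 1/2` -/

section Blind

variable {L Y : Type*} [Fintype L] [DecidableEq L] [Fintype Y] [DecidableEq Y]
variable {pL qL : L → ℝ} {μ : Y → ℝ}

/-- **ESS FLOOR `τ_int(f) ≥ 1/ESS − 1/2`** for every non-constant weight-blind observable of the
exact flow-MCMC chain (positive laws): the reweighting effective-sample-size fraction of the flow
bounds the weight-blind integrated autocorrelation time from below. [ours] -/
theorem blind_tauInt_ge_inv_essFrac (hpL : ∀ l, 0 < pL l) (hpL1 : ∑ l, pL l = 1)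
    (hqL : ∀ l, 0 < qL l) (hqL1 : ∑ l, qL l = 1) (hμ : ∀ y, 0 < μ y) (hμ1 : ∑ y, μ y = 1)
    {g : Y → ℝ} (hg : ∑ y, μ y * g y = 0) (hvar : ∑ y, μ y * g y ^ 2 ≠ 0) :
    (essFrac pL qL)⁻¹ - 1 / 2 ≤
      tauInt (fun t => twoTime (fun z : L × Y => pL z.1 * μ z.2)
        (imhMatrix (fun z : L × Y => pL z.1 * μ z.2) (fun z => qL z.1 * μ z.2)) t
        (fun z => g z.2) (fun z => g z.2) /
      twoTime (fun z : L × Y => pL z.1 * μ z.2)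
        (imhMatrix (fun z : L × Y => pL z.1 * μ z.2) (fun z => qL z.1 * μ z.2)) 0
        (fun z => g z.2) (fun z => g z.2)) := by
  rw [blind_tauInt_eq hpL hpL1 hqL hqL1 hμ hμ1 hg hvar]
  linarith [inv_essFrac_le_sum_div_moveAccept hpL hqL hpL1 (q := qL)]

/-- **OVERLAP CEILING `τ_int(f) ≤ (1/ESS + 1/4)/(1 − TV(pL, qL)) − 1/2`** for every non-constant
weight-blind observable (positive laws). [ours] -/
theorem blind_tauInt_le_of_essFrac_tvDist (hpL : ∀ l, 0 < pL l) (hpL1 : ∑ l, pL l = 1)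
    (hqL : ∀ l, 0 < qL l) (hqL1 : ∑ l, qL l = 1) (hμ : ∀ y, 0 < μ y) (hμ1 : ∑ y, μ y = 1)
    {g : Y → ℝ} (hg : ∑ y, μ y * g y = 0) (hvar : ∑ y, μ y * g y ^ 2 ≠ 0) :
    tauInt (fun t => twoTime (fun z : L × Y => pL z.1 * μ z.2)
        (imhMatrix (fun z : L × Y => pL z.1 * μ z.2) (fun z => qL z.1 * μ z.2)) t
        (fun z => g z.2) (fun z => g z.2) /
      twoTime (fun z : L × Y => pL z.1 * μ z.2)
        (imhMatrix (fun z : L × Y => pL z.1 * μ z.2) (fun z => qL z.1 * μ z.2)) 0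
        (fun z => g z.2) (fun z => g z.2))
      ≤ ((essFrac pL qL)⁻¹ + 1 / 4) / (1 - tvDist pL qL) - 1 / 2 := by
  rw [blind_tauInt_eq hpL hpL1 hqL hqL1 hμ hμ1 hg hvar]
  linarith [sum_div_moveAccept_le hpL hqL hpL1 hqL1]

/-- **ACCEPTANCE CEILING `τ_int(f) ≤ (1/ESS + 1/4)/ā − 1/2`** (`ā = accRate pL qL`, the stationary
acceptance): together with `blind_tauInt_ge_inv_essFrac` and row 8's `blind_tauInt_ge`, the
weight-blind `τ_int` is pinned between `max(1/ESS, 1/ā) − 1/2` and `(1/ESS + 1/4)/ā − 1/2` by the two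
printed population monitors. [ours] -/
theorem blind_tauInt_le_of_essFrac_accRate (hpL : ∀ l, 0 < pL l) (hpL1 : ∑ l, pL l = 1)
    (hqL : ∀ l, 0 < qL l) (hqL1 : ∑ l, qL l = 1) (hμ : ∀ y, 0 < μ y) (hμ1 : ∑ y, μ y = 1)
    {g : Y → ℝ} (hg : ∑ y, μ y * g y = 0) (hvar : ∑ y, μ y * g y ^ 2 ≠ 0) :
    tauInt (fun t => twoTime (fun z : L × Y => pL z.1 * μ z.2)
        (imhMatrix (fun z : L × Y => pL z.1 * μ z.2) (fun z => qL z.1 * μ z.2)) t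
        (fun z => g z.2) (fun z => g z.2) /
      twoTime (fun z : L × Y => pL z.1 * μ z.2)
        (imhMatrix (fun z : L × Y => pL z.1 * μ z.2) (fun z => qL z.1 * μ z.2)) 0
        (fun z => g z.2) (fun z => g z.2))
      ≤ ((essFrac pL qL)⁻¹ + 1 / 4) / accRate pL qL - 1 / 2 := by
  rw [blind_tauInt_eq hpL hpL1 hqL hqL1 hμ hμ1 hg hvar]
  linarith [sum_div_moveAccept_le_div_accRate hpL hqL hpL1 hqL1]

end Blind


/-! ### Appended (GEN-11): the ESS CEILING `τ_int(f) ≤ 2/ESS − 1/2` via the per-state floor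
`a(x) ≥ 1/(1/ESS + w(x))` -/

section MoveAcceptFloor

variable {X : Type*} [Fintype X] [DecidableEq X]

/-- **The per-state acceptance floor `a(x) ≥ 1/(1/ESS + w(x))`** (finite form of the independence
sampler's per-state floor `1/(π(w) + w(x))`; Deligiannidis–Lee 2018 §3 name the continuum statement,
NAMED ONLY — the tree's general-space version is row 2's `Exactness.one_sub_rejCurve_ge`):
`a(x) = Σ_z p_z / max(w_z, w_x) ≥ 1/Σ_z p_z·max(w_z, w_x) ≥ 1/(E_p[w] + w_x)` by Cauchy–Schwarz and
`max ≤ sum`. [ours] -/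
theorem inv_le_moveAccept {p q : X → ℝ} (hp : ∀ x, 0 < p x) (hq : ∀ x, 0 < q x)
    (hp1 : ∑ x, p x = 1) (x : X) :
    1 / ((essFrac p q)⁻¹ + p x / q x) ≤ 1 - liuG p q x x := by
  have hw : ∀ z, 0 < p z / q z := fun z => div_pos (hp z) (hq z)
  set M : X → ℝ := fun z => max (p z / q z) (p x / q x) with hM
  have hMpos : ∀ z, 0 < M z := fun z => lt_max_of_lt_left (hw z)
  -- `a(x) = Σ_z p_z / M_z`
  have ha : 1 - liuG p q x x = ∑ z, p z / M z := by
    rw [one_sub_liuG_diag_eq_sum_min hp x]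
    refine sum_congr rfl fun z _ => ?_
    have e1 : q z = p z / (p z / q z) := by
      rw [div_div_eq_mul_div, mul_div_assoc, mul_div_cancel₀ _ (hp z).ne']
    have e2 : p z * q x / p x = p z / (p x / q x) := by
      field_simp
    rw [e1, e2]
    rcases le_total (p z / q z) (p x / q x) with h | h
    · rw [show M z = p x / q x from max_eq_right h]
      exact min_eq_right (div_le_div_of_nonneg_left (hp z).le (hw z) h)
    · rw [show M z = p z / q z from max_eq_left h]
      exact min_eq_left (div_le_div_of_nonneg_left (hp z).le (hw x) h)
  -- Cauchy–Schwarz: `(Σ p)² ≤ (Σ p M)(Σ p/M)`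
  have hCS : (∑ z, p z) ^ 2 ≤ (∑ z, p z * M z) * ∑ z, p z / M z :=
    sum_sq_le_sum_mul_sum_of_sq_le_mul univ (fun z _ => mul_nonneg (hp z).le (hMpos z).le)
      (fun z _ => div_nonneg (hp z).le (hMpos z).le)
      (fun z _ => le_of_eq (by
        rw [mul_div_assoc', mul_assoc, mul_div_assoc, mul_div_cancel_left₀ _ (hMpos z).ne', sq]))
  rw [hp1, one_pow] at hCS
  -- `Σ p M ≤ 1/ESS + w_x`
  have hsum : ∑ z, p z * M z ≤ (essFrac p q)⁻¹ + p x / q x := by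
    rw [essFrac_eq_inv hq hp1, inv_inv]
    calc ∑ z, p z * M z ≤ ∑ z, (p z * weight p q z + p z * (p x / q x)) :=
          sum_le_sum fun z _ => by
            rw [← mul_add]
            exact mul_le_mul_of_nonneg_left (max_le_add_of_nonneg (hw z).le (hw x).le) (hp z).le
      _ = ∑ z, p z * weight p q z + p x / q x := by
          rw [sum_add_distrib, ← sum_mul, hp1, one_mul]
  have hSpos : 0 < ∑ z, p z * M z :=
    sum_pos (fun z _ => mul_pos (hp z) (hMpos z))
      (nonempty_of_sum_ne_zero (by rw [hp1]; exact one_ne_zero))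
  rw [ha]
  calc 1 / ((essFrac p q)⁻¹ + p x / q x) ≤ 1 / ∑ z, p z * M z :=
        div_le_div_of_nonneg_left zero_le_one hSpos hsum
    _ ≤ ∑ z, p z / M z := by
        rw [div_le_iff₀ hSpos, mul_comm]
        exact hCS

/-- **`E_p[1/a] ≤ 2/ESS`**: `Σ_x p_x / a(x) ≤ Σ_x p_x (1/ESS + w_x) = 2/ESS`. [ours] -/
theorem sum_div_moveAccept_le_two_inv_essFrac {p q : X → ℝ} (hp : ∀ x, 0 < p x)
    (hq : ∀ x, 0 < q x) (hp1 : ∑ x, p x = 1) :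
    ∑ x, p x / (1 - liuG p q x x) ≤ 2 * (essFrac p q)⁻¹ := by
  have hE : 0 < (essFrac p q)⁻¹ := by
    rw [essFrac_eq_inv hq hp1, inv_inv]
    exact sum_pos (fun z _ => mul_pos (hp z) (div_pos (hp z) (hq z)))
      (nonempty_of_sum_ne_zero (by rw [hp1]; exact one_ne_zero))
  calc ∑ x, p x / (1 - liuG p q x x) ≤ ∑ x, p x * ((essFrac p q)⁻¹ + p x / q x) := by
        refine sum_le_sum fun x _ => ?_
        have hD : 0 < (essFrac p q)⁻¹ + p x / q x := add_pos hE (div_pos (hp x) (hq x))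
        calc p x / (1 - liuG p q x x) ≤ p x / (1 / ((essFrac p q)⁻¹ + p x / q x)) :=
              div_le_div_of_nonneg_left (hp x).le (one_div_pos.mpr hD) (inv_le_moveAccept hp hq hp1 x)
          _ = p x * ((essFrac p q)⁻¹ + p x / q x) := by rw [div_div_eq_mul_div, div_one]
    _ = (essFrac p q)⁻¹ + ∑ x, p x * weight p q x := by
        simp_rw [mul_add]
        rw [sum_add_distrib, ← sum_mul, hp1, one_mul]
        rfl
    _ = 2 * (essFrac p q)⁻¹ := by
        rw [essFrac_eq_inv hq hp1, inv_inv]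
        ring

end MoveAcceptFloor

section BlindCeiling

variable {L Y : Type*} [Fintype L] [DecidableEq L] [Fintype Y] [DecidableEq Y]
variable {pL qL : L → ℝ} {μ : Y → ℝ}

/-- **ESS CEILING `τ_int(f) ≤ 2/ESS − 1/2`** for every non-constant weight-blind observable of the
exact flow-MCMC chain (positive laws).  With `blind_tauInt_ge_inv_essFrac`:
`1/ESS − 1/2 ≤ τ_int(f) ≤ 2/ESS − 1/2` — the weight-blind integrated autocorrelation time IS
`1/ESS` up to a factor `2`, for every flow. [ours] -/
theorem blind_tauInt_le_two_inv_essFrac (hpL : ∀ l, 0 < pL l) (hpL1 : ∑ l, pL l = 1)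
    (hqL : ∀ l, 0 < qL l) (hqL1 : ∑ l, qL l = 1) (hμ : ∀ y, 0 < μ y) (hμ1 : ∑ y, μ y = 1)
    {g : Y → ℝ} (hg : ∑ y, μ y * g y = 0) (hvar : ∑ y, μ y * g y ^ 2 ≠ 0) :
    tauInt (fun t => twoTime (fun z : L × Y => pL z.1 * μ z.2)
        (imhMatrix (fun z : L × Y => pL z.1 * μ z.2) (fun z => qL z.1 * μ z.2)) t
        (fun z => g z.2) (fun z => g z.2) /
      twoTime (fun z : L × Y => pL z.1 * μ z.2)
        (imhMatrix (fun z : L × Y => pL z.1 * μ z.2) (fun z => qL z.1 * μ z.2)) 0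
        (fun z => g z.2) (fun z => g z.2))
      ≤ 2 * (essFrac pL qL)⁻¹ - 1 / 2 := by
  rw [blind_tauInt_eq hpL hpL1 hqL hqL1 hμ hμ1 hg hvar]
  linarith [sum_div_moveAccept_le_two_inv_essFrac hpL hqL hpL1 (q := qL)]

/-- **The two-sided ESS law for the weight-blind `τ_int`**, packaged:
`1/ESS − 1/2 ≤ τ_int(f) ≤ 2/ESS − 1/2`. [ours] -/
theorem blind_tauInt_mem_Icc_essFrac (hpL : ∀ l, 0 < pL l) (hpL1 : ∑ l, pL l = 1)
    (hqL : ∀ l, 0 < qL l) (hqL1 : ∑ l, qL l = 1) (hμ : ∀ y, 0 < μ y) (hμ1 : ∑ y, μ y = 1)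
    {g : Y → ℝ} (hg : ∑ y, μ y * g y = 0) (hvar : ∑ y, μ y * g y ^ 2 ≠ 0) :
    tauInt (fun t => twoTime (fun z : L × Y => pL z.1 * μ z.2)
        (imhMatrix (fun z : L × Y => pL z.1 * μ z.2) (fun z => qL z.1 * μ z.2)) t
        (fun z => g z.2) (fun z => g z.2) /
      twoTime (fun z : L × Y => pL z.1 * μ z.2)
        (imhMatrix (fun z : L × Y => pL z.1 * μ z.2) (fun z => qL z.1 * μ z.2)) 0
        (fun z => g z.2) (fun z => g z.2))
      ∈ Set.Icc ((essFrac pL qL)⁻¹ - 1 / 2) (2 * (essFrac pL qL)⁻¹ - 1 / 2) :=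
  ⟨blind_tauInt_ge_inv_essFrac hpL hpL1 hqL hqL1 hμ hμ1 hg hvar,
    blind_tauInt_le_two_inv_essFrac hpL hpL1 hqL hqL1 hμ hμ1 hg hvar⟩

end BlindCeiling


/-! ### Appended (GEN-11): the variance-inflation factor of the chain, `(1 + 2τ_int)·ESS ∈ [2, 4]` -/

section Inflation

variable {L Y : Type*} [Fintype L] [DecidableEq L] [Fintype Y] [DecidableEq Y]
variable {pL qL : L → ℝ} {μ : Y → ℝ}

/-- **CHAIN VERSUS REWEIGHTING for weight-blind observables**: the exact chain's asymptotic
variance-inflation factor `1 + 2τ_int(f) = 2·E_p[1/a]` satisfies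
`2/ESS ≤ 1 + 2τ_int(f) ≤ 4/ESS`, i.e. `(1 + 2τ_int(f))·ESS ∈ [2, 4]`.  For comparison (not typed
here): self-normalised REWEIGHTING of the same i.i.d. proposals has delta-method inflation
`E_q[w²] = 1/ESS` for an observable independent of the weight — so on weight-blind observables the
Metropolised flow sampler spends between `2×` and `4×` the proposals of importance reweighting per
unit of precision, for every flow. [ours] -/
theorem blind_one_add_two_mul_tauInt_mem_Icc (hpL : ∀ l, 0 < pL l) (hpL1 : ∑ l, pL l = 1)
    (hqL : ∀ l, 0 < qL l) (hqL1 : ∑ l, qL l = 1) (hμ : ∀ y, 0 < μ y) (hμ1 : ∑ y, μ y = 1)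
    {g : Y → ℝ} (hg : ∑ y, μ y * g y = 0) (hvar : ∑ y, μ y * g y ^ 2 ≠ 0) :
    1 + 2 * tauInt (fun t => twoTime (fun z : L × Y => pL z.1 * μ z.2)
        (imhMatrix (fun z : L × Y => pL z.1 * μ z.2) (fun z => qL z.1 * μ z.2)) t
        (fun z => g z.2) (fun z => g z.2) /
      twoTime (fun z : L × Y => pL z.1 * μ z.2)
        (imhMatrix (fun z : L × Y => pL z.1 * μ z.2) (fun z => qL z.1 * μ z.2)) 0
        (fun z => g z.2) (fun z => g z.2))
      ∈ Set.Icc (2 * (essFrac pL qL)⁻¹) (4 * (essFrac pL qL)⁻¹) := by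
  obtain ⟨h1, h2⟩ := blind_tauInt_mem_Icc_essFrac hpL hpL1 hqL hqL1 hμ hμ1 hg hvar
  constructor <;> linarith

end Inflation

end Summit.Ventures.LatticeQCDFlow.Scoring
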